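import Summits.CriticalPhenomena.SAWScalingLimit.Theorems.SAWTotalPositivityTPToTraversalBoundDiveDefs

/-!
# `n` disjoint traversals give the canonical clock sequence — stub `travSeq_of_hasNTrav`

Line `exit-mass-unforced-dive` of the crux `SAWTotalPositivity.TPToTraversalBound`
(stmt-CriticalPhenomena-10687).  This file proves the registered stub `travSeq_of_hasNTrav`
(vocabulary `IsTraversal`, `HasNTrav`, `TravSeq` in `…TPToTraversalBoundDiveDefs.lean`): if a lattice
walk `q` makes `n` index-disjoint traversals of the annulus `A(z₀, r, R)` in order (`HasNTrav … q n`),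
then the greedy CANONICAL sequence `E 0 = 0`, `E (m+1)` = least completion index of a traversal starting
at or after `E m`, is defined up to level `n` (`∃ E, TravSeq … q n E`).  It is the conversion used by the
assembly of the line to turn "the future makes `n` clock traversals" into the clock `E` along which the
charges are judged.

## Proof

Greedy and elementary.  Let `(i m, j m)`, `m < n`, be the given traversals, `j m ≤ i m'` for `m < m'`.
By induction on `m ≤ n` we build `E` with `TravSeq … q m E` together with the invariant
`E m ≤ i m` (for `m < n`).  At `m = 0`, `E 0 = 0 ≤ i 0`.  At the step `m → m + 1` (`m < n`) the given
traversal `(i m, j m)` starts at or after `E m`, so the set of completion indices `j'` of traversals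
`(i', j')` with `E m ≤ i'` is nonempty; `E (m+1) := Nat.find` of it is attained (`Nat.find_spec`) and
minimal (`Nat.find_min'`), in particular `E (m+1) ≤ j m ≤ i (m+1)`.  Since `TravSeq … q m E` only reads
`E 0, …, E m`, the extension `l ↦ if l ≤ m then E l else E (m+1)` keeps the lower levels.

Sources: A. Kemppainen, S. Smirnov, Ann. Probab. 45 (2017) 698–779 = arXiv:1212.6215, §3.2 (the
canonical crossing times of an annulus).  Deliberately NOT here: anything about the other stubs of the
line (`hasNTrav_of_hasTraversals`, the multi-dive bound and its own `TravSeq` API); no definitions.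
-/

open Literature.Probability.LatticeModels Literature.Probability.RandomPlanarGeometry

namespace Summit.CriticalPhenomena.SAWScalingLimit.Theorems.TPToTraversalBound.ExitMass

/-- **`n` index-disjoint traversals in order give the canonical clock sequence up to level `n`.**
If `q` makes `n` separate traversals of `A(z₀, r, R)` (`HasNTrav δ z₀ r R q n`), then there is
`E : ℕ → ℕ` with `TravSeq δ z₀ r R q n E`: `E 0 = 0` and, for every `m < n`, `E (m+1)` is the least
completion index of a traversal of `A(z₀, r, R)` by `q` starting at or after `E m` (greedy choice,
`Nat.find`; the invariant of the induction is `E m ≤ i m` for the given `m`-th traversal `(i m, j m)`).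
[folklore] -/
theorem travSeq_of_hasNTrav : ∀ {Ω : Set ℂ} (δ : ℝ) (z₀ : ℂ) (r R : ℝ) {v b : Site 2} (q : (discreteDomainGraph Ω δ).Walk v b) (n : ℕ), HasNTrav δ z₀ r R q n → ∃ E : ℕ → ℕ, TravSeq δ z₀ r R q n E := by
  rintro Ω δ z₀ r R v b q n ⟨i, j, htr, hdisj⟩
  -- the induction on the level `m ≤ n`, with the invariant `E m ≤ i m`
  suffices H : ∀ m, m ≤ n →
      ∃ E : ℕ → ℕ, TravSeq δ z₀ r R q m E ∧ ∀ hm : m < n, E m ≤ i ⟨m, hm⟩ by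
    obtain ⟨E, hE, -⟩ := H n le_rfl
    exact ⟨E, hE⟩
  intro m
  induction m with
  | zero =>
    intro _
    exact ⟨fun _ => 0, ⟨rfl, fun m hm => (Nat.not_lt_zero m hm).elim⟩, fun _ => Nat.zero_le _⟩
  | succ m ih =>
    intro hm1
    have hm : m < n := hm1
    obtain ⟨E, hE, hEi⟩ := ih hm.le
    classical
    -- the given `m`-th traversal starts at or after `E m`: the greedy choice is possible
    have hex : ∃ j', ∃ i', E m ≤ i' ∧ IsTraversal δ z₀ r R q i' j' :=
      ⟨j ⟨m, hm⟩, i ⟨m, hm⟩, hEi hm, htr _⟩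
    have hfind : Nat.find hex ≤ j ⟨m, hm⟩ := Nat.find_min' hex ⟨i ⟨m, hm⟩, hEi hm, htr _⟩
    refine ⟨fun l => if l ≤ m then E l else Nat.find hex, ⟨?_, ?_⟩, ?_⟩
    · -- level `0` is unchanged
      show (if 0 ≤ m then E 0 else Nat.find hex) = 0
      rw [if_pos (Nat.zero_le m), hE.1]
    · intro k hk
      show ∃ i₀, (if k ≤ m then E k else Nat.find hex) ≤ i₀ ∧
          IsTraversal δ z₀ r R q i₀ (if k + 1 ≤ m then E (k + 1) else Nat.find hex) ∧
          ∀ i' j', (if k ≤ m then E k else Nat.find hex) ≤ i' → IsTraversal δ z₀ r R q i' j' →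
            (if k + 1 ≤ m then E (k + 1) else Nat.find hex) ≤ j'
      rcases Nat.lt_succ_iff_lt_or_eq.1 hk with hk | rfl
      · -- a lower level `k < m`: read off from `E`
        rw [if_pos hk.le, if_pos (Nat.succ_le_of_lt hk)]
        exact hE.2 k hk
      · -- the new level `k = m`: the greedy choice
        rw [if_pos le_rfl, if_neg (Nat.not_succ_le_self k)]
        obtain ⟨i', hi', htr'⟩ := Nat.find_spec hex
        exact ⟨i', hi', htr', fun i'' j'' hi'' htr'' => Nat.find_min' hex ⟨i'', hi'', htr''⟩⟩
    · -- the invariant at level `m + 1`: `E (m+1) ≤ j m ≤ i (m+1)`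
      intro hm1'
      show (if m + 1 ≤ m then E (m + 1) else Nat.find hex) ≤ i ⟨m + 1, hm1'⟩
      rw [if_neg (Nat.not_succ_le_self m)]
      exact hfind.trans (hdisj (show (⟨m, hm⟩ : Fin n) < ⟨m + 1, hm1'⟩ from Nat.lt_succ_self m))

end Summit.CriticalPhenomena.SAWScalingLimit.Theorems.TPToTraversalBound.ExitMass
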